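import Summits.Ventures.HodgeRepro2.T5InertCongruenceSubgroups
import Summits.Ventures.HodgeRepro2.T5InertThreeTermRecurrence

/-!
# The Iwahori factorisation `K_{a,b} = N_{a,b} · (K ∩ B⁻)` and the transfer of the index
(cell pub-hodge-repro2, seat p3)

Tier-5 N3 support, towards the count `deg Tₙ = [K : K ∩ aₙ K aₙ⁻¹] = (q³ + 1) q^{4n−3}` of
T5-SATAKE-KERNEL-p3.md row 11 (continuation of files 195–197). The index of one congruence subgroup
`K_{a',b'}` (file 197) in another, `K_{a,b}`, is computed on the unipotent radical `N_{a,b}` (file 195):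

* `isInteger_inv_entry_two_two` — for `κ ∈ K` with `κ₀₂, κ₁₂ ∈ ϖ R` the entry `κ₂₂` is a unit
  (`star κ₀₀ · κ₂₂ ≡ 1 mod ϖ`, the unitary relation of the columns `0, 2`);
* **`exists_unipCong_inv_mul_mem_lower`** — the IWAHORI (UL) FACTORISATION: for `a ≥ 1` every `κ ∈ K_{a,b}` is
  `ν · λ` with `ν ∈ N_{a,b}` and `λ ∈ K` lower triangular (`λ₀₁ = λ₀₂ = λ₁₂ = 0`): `ν⁻¹ = n(−X, Z')` with
  `X = −u κ̄₁₂/κ̄₂₂`, `Z' = (X κ₁₂ − κ₀₂)/κ₂₂` kills the entries `(1, 2)` and `(0, 2)`, the unitary relation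
  of column `2` puts `ν` in `U(J₃(u))` (`upper3_relation_aux`), and the entry `(0, 1)` of a unitary matrix
  vanishes with `(0, 2)`, `(1, 2)` (file 197's `entry_zero_one_eq_zero`);
* **`relIndex_congSubgroup_eq_relIndex_unipCong`** — `[K_{a,b} : K_{a',b'}] = [N_{a,b} : N_{a',b'}]` for
  `1 ≤ a ≤ a'`, `b ≤ b'` (the transfer lemma of file 197 + `N_{a,b} ∩ K_{a',b'} = N_{a',b'}`).

With file 196 (`[N_{a,b} : N_{a+1,b}] = #𝔽`, `[N_{a,b} : N_{a,b+1}] = #{trace zero}`) this evaluates every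
step of the tower `K_{1,1} ⊃ K_{1,2} ⊃ K_{2,4} ⊃ … ⊃ K_{n,2n}`; the first step `[K : K_{1,1}]` is the count
of isotropic lines (next file).

Mathlib + this seat's files 189 / 197 and their imports; no display; no device.
§8(d): uses an L-value-free non-vanishing device: NO.
-/

namespace Summit.Ventures.HodgeRepro2.T5InertIwahoriFactorisation

open Matrix
open Summit.Ventures.HodgeRepro2.T5CartanCellsDistinct Summit.Ventures.HodgeRepro2.T5HermitianThreeElements
  Summit.Ventures.HodgeRepro2.T5UnitaryGroupForm Summit.Ventures.HodgeRepro2.T5UnitaryThreeCorner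
  Summit.Ventures.HodgeRepro2.T5UnitaryHeckeAdjoint Summit.Ventures.HodgeRepro2.T5InertTopCoefficientMatrix
  Summit.Ventures.HodgeRepro2.T5InertUnipotentCongruence Summit.Ventures.HodgeRepro2.T5InertCongruenceSubgroups
  Summit.Ventures.HodgeRepro2.T5InertThreeTermRecurrence

/-! ## The Iwahori factorisation `K_{a,b} = N_{a,b} · (K ∩ B⁻)` -/

section Iwahori

variable {R E : Type*} [CommRing R] [IsDomain R] [IsDiscreteValuationRing R] [Field E] [StarRing E]
  [Algebra R E] [IsFractionRing R E]
  (hstar : ∀ x : E, IsLocalization.IsInteger R x → IsLocalization.IsInteger R (star x))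
  (u : E) (hsu : star u = u) (hu0 : u ≠ 0) (hu : IsLocalization.IsInteger R u)
  (hu' : IsLocalization.IsInteger R u⁻¹)
  {ϖ : R} (hϖ : Irreducible ϖ) (hs : star (algebraMap R E ϖ) = algebraMap R E ϖ)
  {a b : ℕ} {hab : a ≤ b} {hba : b ≤ 2 * a}

include hstar hu hϖ in
/-- For `κ ∈ K` with `κ₀₂ ∈ ϖ R` and `κ₁₂ ∈ ϖ R`, the entry `κ₂₂` is a unit of `R`:
`star κ₀₀ · κ₂₂ ≡ 1 mod ϖ` by the unitary relation of the columns `0, 2`. -/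
theorem isInteger_inv_entry_two_two {κ : formUnitaryGroup (J3 u)} (hκ : κ ∈ hyperspecialSubgroup R (J3 u))
    (h02 : IsLocalization.IsInteger R
      (((κ : GL (Fin 3) E) : Matrix (Fin 3) (Fin 3) E) 0 2 * (algebraMap R E ϖ)⁻¹))
    (h12 : IsLocalization.IsInteger R
      (((κ : GL (Fin 3) E) : Matrix (Fin 3) (Fin 3) E) 1 2 * (algebraMap R E ϖ)⁻¹)) :
    IsLocalization.IsInteger R (((κ : GL (Fin 3) E) : Matrix (Fin 3) (Fin 3) E) 2 2)⁻¹ ∧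
      ((κ : GL (Fin 3) E) : Matrix (Fin 3) (Fin 3) E) 2 2 ≠ 0 := by
  have hκi := isInteger_apply_of_mem_range ((mem_hyperspecialSubgroup_iff R κ).1 hκ)
  have hrel := (mem_iff_fin_three u (κ : GL (Fin 3) E) _ _ _ _ _ _ _ _ _
    (coe_eq_fin_three (κ : GL (Fin 3) E))).1 κ.2
  have h02' := hrel.2.2.1
  have hπ0 : algebraMap R E ϖ ≠ 0 :=
    (map_ne_zero_iff _ (IsFractionRing.injective R E)).2 hϖ.ne_zero
  -- `A := star κ₀₀ · κ₂₂ = 1 − ϖ y` with `y` integral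
  obtain ⟨a₀, ha₀⟩ := IsLocalization.isInteger_mul (hstar _ (hκi 0 0)) (hκi 2 2)
  obtain ⟨y₀, hy₀⟩ := IsLocalization.isInteger_add
    (IsLocalization.isInteger_mul (hstar _ (hκi 2 0)) h02)
    (IsLocalization.isInteger_mul (IsLocalization.isInteger_mul (hstar _ (hκi 1 0)) hu) h12)
  have hrel' : a₀ + ϖ * y₀ = 1 := by
    apply IsFractionRing.injective R E
    rw [map_add, map_mul, map_one, ha₀, hy₀, ← h02']
    field_simp
    ring
  have ha₀unit : IsUnit a₀ := isUnit_of_add_irreducible_mul_eq_one hϖ hrel'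
  have hAinv : IsLocalization.IsInteger R
      (star (((κ : GL (Fin 3) E) : Matrix (Fin 3) (Fin 3) E) 0 0) *
        ((κ : GL (Fin 3) E) : Matrix (Fin 3) (Fin 3) E) 2 2)⁻¹ := by
    rw [← ha₀]
    exact isInteger_inv_of_isUnit ha₀unit
  have hA0 : star (((κ : GL (Fin 3) E) : Matrix (Fin 3) (Fin 3) E) 0 0) *
      ((κ : GL (Fin 3) E) : Matrix (Fin 3) (Fin 3) E) 2 2 ≠ 0 := by
    rw [← ha₀]
    exact (map_ne_zero_iff _ (IsFractionRing.injective R E)).2 ha₀unit.ne_zero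
  have h22 : ((κ : GL (Fin 3) E) : Matrix (Fin 3) (Fin 3) E) 2 2 ≠ 0 := right_ne_zero_of_mul hA0
  refine ⟨?_, h22⟩
  have : (((κ : GL (Fin 3) E) : Matrix (Fin 3) (Fin 3) E) 2 2)⁻¹ =
      star (((κ : GL (Fin 3) E) : Matrix (Fin 3) (Fin 3) E) 0 0) *
        (star (((κ : GL (Fin 3) E) : Matrix (Fin 3) (Fin 3) E) 0 0) *
          ((κ : GL (Fin 3) E) : Matrix (Fin 3) (Fin 3) E) 2 2)⁻¹ := by
    have h00 : star (((κ : GL (Fin 3) E) : Matrix (Fin 3) (Fin 3) E) 0 0) ≠ 0 := left_ne_zero_of_mul hA0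
    field_simp
  rw [this]
  exact IsLocalization.isInteger_mul (hstar _ (hκi 0 0)) hAinv

omit [IsDomain R] [IsDiscreteValuationRing R] [Algebra R E] [IsFractionRing R E] in
include hsu in
/-- The unitary relation of `n(−X, Z')` for `X = −u f̄ / r̄`, `Z' = (X f − c)/r`, as a field identity. -/
theorem upper3_relation_aux (f c r : E) (hr : r ≠ 0) (hsr : star r ≠ 0) :
    (-u * star f / star r * f - c) / r + star ((-u * star f / star r * f - c) / r) +
        star (-u * star f / star r) * (-u * star f / star r) / u =
      -(star r * c + star f * u * f + star c * r) / (r * star r) := by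
  simp only [star_div₀, star_sub, star_mul, star_neg, star_star, hsu]
  field_simp
  ring

omit [IsDomain R] [IsDiscreteValuationRing R] in
include hstar hsu hu0 hu hu' hϖ hs in
/-- **The Iwahori factorisation, core form.** For `κ ∈ K` with `κ₀₂ ∈ ϖ^b R`, `κ₁₂ ∈ ϖ^a R` (`b ≤ 2a`) and
`κ₂₂` a unit of `R`, `κ = ν · λ` with `ν ∈ N_{a,b}` and `λ ∈ K` lower triangular: `λ₀₁ = λ₀₂ = λ₁₂ = 0`. -/
theorem exists_unipCong_inv_mul_mem_lower_of_isUnit {κ : formUnitaryGroup (J3 u)}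
    (hκK : κ ∈ hyperspecialSubgroup R (J3 u))
    (hκ02 : IsLocalization.IsInteger R
      (((κ : GL (Fin 3) E) : Matrix (Fin 3) (Fin 3) E) 0 2 * algebraMap R E ϖ ^ (-(b : ℤ))))
    (hκ12 : IsLocalization.IsInteger R
      (((κ : GL (Fin 3) E) : Matrix (Fin 3) (Fin 3) E) 1 2 * algebraMap R E ϖ ^ (-(a : ℤ))))
    (hrinv : IsLocalization.IsInteger R (((κ : GL (Fin 3) E) : Matrix (Fin 3) (Fin 3) E) 2 2)⁻¹)
    (hr0 : ((κ : GL (Fin 3) E) : Matrix (Fin 3) (Fin 3) E) 2 2 ≠ 0) :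
    ∃ ν ∈ unipCong hstar u hu' hs a b hba, ν⁻¹ * κ ∈ hyperspecialSubgroup R (J3 u) ∧
      (((ν⁻¹ * κ : formUnitaryGroup (J3 u)) : GL (Fin 3) E) : Matrix (Fin 3) (Fin 3) E) 0 1 = 0 ∧
      (((ν⁻¹ * κ : formUnitaryGroup (J3 u)) : GL (Fin 3) E) : Matrix (Fin 3) (Fin 3) E) 0 2 = 0 ∧
      (((ν⁻¹ * κ : formUnitaryGroup (J3 u)) : GL (Fin 3) E) : Matrix (Fin 3) (Fin 3) E) 1 2 = 0 := by
  have hκi := isInteger_apply_of_mem_range ((mem_hyperspecialSubgroup_iff R κ).1 hκK)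
  have hπ0 : algebraMap R E ϖ ≠ 0 :=
    (map_ne_zero_iff _ (IsFractionRing.injective R E)).2 hϖ.ne_zero
  have hπint : ∀ n : ℕ, IsLocalization.IsInteger R (algebraMap R E ϖ ^ n) := fun n => isInteger_pow ϖ n
  -- the entries
  set c : E := ((κ : GL (Fin 3) E) : Matrix (Fin 3) (Fin 3) E) 0 2 with hc
  set f : E := ((κ : GL (Fin 3) E) : Matrix (Fin 3) (Fin 3) E) 1 2 with hf
  set r : E := ((κ : GL (Fin 3) E) : Matrix (Fin 3) (Fin 3) E) 2 2 with hr
  have hsr0 : star r ≠ 0 := star_ne_zero.2 hr0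
  have hsrinv : IsLocalization.IsInteger R (star r)⁻¹ := isInteger_star_inv hstar hrinv
  -- the unitary relation of the column `2`: `star r * c + star f * u * f + star c * r = 0`
  have hrel := (mem_iff_fin_three u (κ : GL (Fin 3) E) _ _ _ _ _ _ _ _ _
    (coe_eq_fin_three (κ : GL (Fin 3) E))).1 κ.2
  have h22 : star r * c + star f * u * f + star c * r = 0 := hrel.2.2.2.2.2.2.2.2
  -- the unipotent `ν' = n(−X, Z')`, `X = −u f̄ / r̄`, `Z' = (X f − c)/r`; `ν := ν'⁻¹`
  set X : E := -u * star f / star r with hX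
  set Z' : E := (X * f - c) / r with hZ'
  have hr0' : r ≠ 0 := hr0
  have hXs : star X = -u * f / r := by
    rw [hX, star_div₀, star_mul, star_neg, star_star, star_star, hsu, mul_comm f]
  have hν'mem : upper3 u (-X) Z' ∈ formUnitaryGroup (J3 u) := by
    apply upper3_mem u hsu hu0
    rw [star_neg, neg_mul_neg]
    have : Z' + star Z' + star X * X / u = -(star r * c + star f * u * f + star c * r) / (r * star r) := by
      rw [hZ', hX]
      exact upper3_relation_aux u hsu f c r hr0' hsr0
    rw [this, h22, neg_zero, zero_div]
  -- the coordinates of `ν'`: `−X ∈ ϖ^a R`, `Z' ∈ ϖ^b R`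
  obtain ⟨f', hf'⟩ := hκ12
  obtain ⟨c', hc'⟩ := hκ02
  have hfe : f = algebraMap R E ϖ ^ a * algebraMap R E f' := by
    rw [hf', mul_comm (algebraMap R E ϖ ^ a), mul_assoc, ← zpow_natCast (algebraMap R E ϖ) a,
      ← zpow_add₀ hπ0, neg_add_cancel, zpow_zero, mul_one]
  have hce : c = algebraMap R E ϖ ^ b * algebraMap R E c' := by
    rw [hc', mul_comm (algebraMap R E ϖ ^ b), mul_assoc, ← zpow_natCast (algebraMap R E ϖ) b,
      ← zpow_add₀ hπ0, neg_add_cancel, zpow_zero, mul_one]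
  obtain ⟨fs, hfs⟩ := hstar _ ⟨f', rfl⟩
  obtain ⟨rs, hrs⟩ := hsrinv
  obtain ⟨ri, hri⟩ := hrinv
  obtain ⟨u₀, hu₀⟩ := hu
  have hXe : -X = algebraMap R E ϖ ^ a * algebraMap R E (u₀ * fs * rs) := by
    rw [hX, hfe, star_mul, star_pow, hs, ← hfs, map_mul, map_mul, hu₀, hrs, neg_mul, neg_div, neg_neg,
      div_eq_mul_inv]
    ring
  have hZ'e : Z' = algebraMap R E ϖ ^ b *
      algebraMap R E (-(ϖ ^ (2 * a - b) * (u₀ * fs * rs) * f') * ri - c' * ri) := by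
    have h2a : algebraMap R E ϖ ^ b * algebraMap R E ϖ ^ (2 * a - b) =
        algebraMap R E ϖ ^ a * algebraMap R E ϖ ^ a := by
      rw [← pow_add, Nat.add_sub_cancel' hba, two_mul, pow_add]
    have hXe' : X = -(algebraMap R E ϖ ^ a * algebraMap R E (u₀ * fs * rs)) := by
      rw [← hXe, neg_neg]
    rw [hZ', hXe', hfe, hce, div_eq_mul_inv, ← hri]
    simp only [map_sub, map_neg, map_mul, map_pow]
    linear_combination (algebraMap R E u₀ * algebraMap R E fs * algebraMap R E rs * algebraMap R E f' *
      algebraMap R E ri) * h2a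
  have hν'N : (⟨upper3 u (-X) Z', hν'mem⟩ : formUnitaryGroup (J3 u)) ∈ unipCong hstar u hu' hs a b hba :=
    ⟨u₀ * fs * rs, -(ϖ ^ (2 * a - b) * (u₀ * fs * rs) * f') * ri - c' * ri, by
      show upper3 u (-X) Z' = _
      rw [hXe, hZ'e]⟩
  refine ⟨(⟨upper3 u (-X) Z', hν'mem⟩ : formUnitaryGroup (J3 u))⁻¹, Subgroup.inv_mem _ hν'N, ?_⟩
  rw [inv_inv]
  -- the entries of `ν' κ`
  have hprod : (((⟨upper3 u (-X) Z', hν'mem⟩ * κ : formUnitaryGroup (J3 u)) : GL (Fin 3) E) :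
      Matrix (Fin 3) (Fin 3) E) = (upper3 u (-X) Z' : Matrix (Fin 3) (Fin 3) E) * (κ : GL (Fin 3) E) := by
    rw [Subgroup.coe_mul, Units.val_mul]
  have e02 : (((⟨upper3 u (-X) Z', hν'mem⟩ * κ : formUnitaryGroup (J3 u)) : GL (Fin 3) E) :
      Matrix (Fin 3) (Fin 3) E) 0 2 = 0 := by
    rw [hprod, coe_upper3, coe_eq_fin_three (κ : GL (Fin 3) E), Matrix.mul_fin_three]
    show 1 * c + -X * f + Z' * r = 0
    rw [hZ']
    linear_combination (X * f - c) * mul_inv_cancel₀ hr0'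
  have e12 : (((⟨upper3 u (-X) Z', hν'mem⟩ * κ : formUnitaryGroup (J3 u)) : GL (Fin 3) E) :
      Matrix (Fin 3) (Fin 3) E) 1 2 = 0 := by
    rw [hprod, coe_upper3, coe_eq_fin_three (κ : GL (Fin 3) E), Matrix.mul_fin_three]
    show 0 * c + 1 * f + -star (-X) / u * r = 0
    rw [star_neg, neg_neg, hXs]
    linear_combination (-(f * (r * r⁻¹))) * mul_inv_cancel₀ hu0 + (-f) * mul_inv_cancel₀ hr0'
  refine ⟨?_, ?_, e02, e12⟩
  · -- `ν' κ ∈ K`: both factors have integral entries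
    have hν'range : upper3 u (-X) Z' ∈ (Matrix.GeneralLinearGroup.map (algebraMap R E)).range := by
      have h1 : IsLocalization.IsInteger R (-X) := by
        rw [hXe]
        exact IsLocalization.isInteger_mul (hπint a) ⟨_, rfl⟩
      have h2 : IsLocalization.IsInteger R Z' := by
        rw [hZ'e]
        exact IsLocalization.isInteger_mul (hπint b) ⟨_, rfl⟩
      refine upper3_mem_range h1 h2 ?_
      rw [div_eq_mul_inv]
      exact IsLocalization.isInteger_mul (hstar _ h1) hu'
    rw [mem_hyperspecialSubgroup_iff, Subgroup.coe_mul]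
    exact Subgroup.mul_mem _ hν'range ((mem_hyperspecialSubgroup_iff R κ).1 hκK)
  · exact entry_zero_one_eq_zero u (Subgroup.mul_mem _ hν'mem κ.2) e02 e12

include hstar hsu hu0 hu hu' hϖ hs in
/-- **The Iwahori factorisation.** For `a ≥ 1` (and `a ≤ b ≤ 2a`), every `κ ∈ K_{a,b}` is `ν · λ` with
`ν ∈ N_{a,b}` and `λ ∈ K` lower triangular: `λ₀₁ = λ₀₂ = λ₁₂ = 0`. -/
theorem exists_unipCong_inv_mul_mem_lower (ha : 1 ≤ a) {κ : formUnitaryGroup (J3 u)}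
    (hκ : κ ∈ congSubgroup hstar u hu0 hu hu' hϖ hs a b hab hba) :
    ∃ ν ∈ unipCong hstar u hu' hs a b hba, ν⁻¹ * κ ∈ hyperspecialSubgroup R (J3 u) ∧
      (((ν⁻¹ * κ : formUnitaryGroup (J3 u)) : GL (Fin 3) E) : Matrix (Fin 3) (Fin 3) E) 0 1 = 0 ∧
      (((ν⁻¹ * κ : formUnitaryGroup (J3 u)) : GL (Fin 3) E) : Matrix (Fin 3) (Fin 3) E) 0 2 = 0 ∧
      (((ν⁻¹ * κ : formUnitaryGroup (J3 u)) : GL (Fin 3) E) : Matrix (Fin 3) (Fin 3) E) 1 2 = 0 := by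
  obtain ⟨hκK, -, hκ02, hκ12⟩ := hκ
  have hπ0 : algebraMap R E ϖ ≠ 0 :=
    (map_ne_zero_iff _ (IsFractionRing.injective R E)).2 hϖ.ne_zero
  have hπint : ∀ n : ℕ, IsLocalization.IsInteger R (algebraMap R E ϖ ^ n) := fun n => isInteger_pow ϖ n
  have hb1 : 1 ≤ b := le_trans ha hab
  have h02' : IsLocalization.IsInteger R
      (((κ : GL (Fin 3) E) : Matrix (Fin 3) (Fin 3) E) 0 2 * (algebraMap R E ϖ)⁻¹) := by
    have := IsLocalization.isInteger_mul hκ02 (hπint (b - 1))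
    rwa [mul_assoc, ← zpow_natCast, ← zpow_add₀ hπ0, show (-(b : ℤ) + ((b - 1 : ℕ) : ℤ)) = -1 by
      push_cast [Nat.cast_sub hb1]; ring, _root_.zpow_neg_one] at this
  have h12' : IsLocalization.IsInteger R
      (((κ : GL (Fin 3) E) : Matrix (Fin 3) (Fin 3) E) 1 2 * (algebraMap R E ϖ)⁻¹) := by
    have := IsLocalization.isInteger_mul hκ12 (hπint (a - 1))
    rwa [mul_assoc, ← zpow_natCast, ← zpow_add₀ hπ0, show (-(a : ℤ) + ((a - 1 : ℕ) : ℤ)) = -1 by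
      push_cast [Nat.cast_sub ha]; ring, _root_.zpow_neg_one] at this
  obtain ⟨hrinv, hr0⟩ := isInteger_inv_entry_two_two hstar u hu hϖ hκK h02' h12'
  exact exists_unipCong_inv_mul_mem_lower_of_isUnit hstar u hsu hu0 hu hu' hϖ hs hκK hκ02 hκ12 hrinv hr0

include hstar hsu hu0 hu hu' hϖ hs in
/-- **`[K_{a,b} : K_{a',b'}] = [N_{a,b} : N_{a',b'}]`** for `1 ≤ a ≤ a'`, `b ≤ b'` (both pairs with
`a ≤ b ≤ 2a`): the Iwahori factorisation transports the index to the unipotent radical. -/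
theorem relIndex_congSubgroup_eq_relIndex_unipCong {a' b' : ℕ} {hab' : a' ≤ b'} {hba' : b' ≤ 2 * a'}
    (ha1 : 1 ≤ a) (ha : a ≤ a') (hb : b ≤ b') :
    (congSubgroup hstar u hu0 hu hu' hϖ hs a' b' hab' hba').relIndex
        (congSubgroup hstar u hu0 hu hu' hϖ hs a b hab hba) =
      (unipCong hstar u hu' hs a' b' hba').relIndex (unipCong hstar u hu' hs a b hba) := by
  rw [relIndex_eq_of_forall_exists (N := unipCong hstar u hu' hs a b hba)
    (unipCong_le_congSubgroup hstar u hu0 hu hu' hϖ hs) ?_]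
  · rw [← Subgroup.inf_relIndex_right, inf_comm,
      unipCong_inf_congSubgroup hstar u hu0 hu hu' hϖ hs ha hb]
  · intro κ hκ
    obtain ⟨ν, hν, hK, h01, h02, h12⟩ :=
      exists_unipCong_inv_mul_mem_lower hstar u hsu hu0 hu hu' hϖ hs ha1 hκ
    refine ⟨ν, hν, hK, ?_, ?_, ?_⟩
    · rw [h01, zero_mul]
      exact ⟨0, map_zero _⟩
    · rw [h02, zero_mul]
      exact ⟨0, map_zero _⟩
    · rw [h12, zero_mul]
      exact ⟨0, map_zero _⟩

end Iwahori

end Summit.Ventures.HodgeRepro2.T5InertIwahoriFactorisation
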